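import Summits.CriticalPhenomena.PercolationContinuityZ3.Theorems.PercNearOneGluingNoHeavyLowerTailTwoPortPeelingSlices
import HarnessLib

/-!
# `NoHeavyLowerTail` (stmt-CriticalPhenomena-4575) — CS₂ when the partner is a TWO-PORT star: the mixed-slice reduction

Route `PercNearOneGluingNoHeavy`, seat `prim-gen-swap` (gen 5); seat memo TWO-PORT-PEELING.md.  `μ_w = prodBernoulli w` on
`Fin n`, relays `A`, level `j`, `π(z) = {a ∈ A : z ↔ a}`, `R_a = {|π(a)| ≤ j}`, `L_u = {1 ≤ |π(u)| ≤ j}`; CS₂ pair events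
`ℓ = {c ↮ u, c ↮ v, 1 ≤ |π(u) ∪ π(v)| ≤ j}`, `ρ = {c ↮ u, c ↮ v, |π(c)| ≤ j}`, and `Ψ_{w'} := μ_{w'}(ρ) − μ_{w'}(ℓ)`.

SETTING.  `u` is an ARBITRARY vertex (no hypothesis on its neighbourhood, not even `u ∉ A`), `v ∉ A` is a two-port star: its
only pairs of possibly positive weight are `e = s(v,b)`, `e' = s(v,b')` (`b ≠ b'` relays), weights `β, β'`; `θ := β β'`.
Scenario weights `w₀₀, w₁₀, w₀₁, w₁₁` = `w` with `(e, e')` pinned to `(0,0), (1,0), (0,1), (1,1)`.  If `c ∈ A` is a champion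
of `w`, then

* `TwoPortPeeling.mixed_hubMove`     : `(1 − θ) Ψ_{w₁₀} + θ Ψ_{w₁₁} ≥ 0` (and symmetrically for `w₀₁`): hub-move
  (`Literature…twoObserver_le_of_lonelier`) in the weights `v–b ↦ 1, v–b' ↦ θ`, which have the relay law of `w`;
* `TwoPortPeeling.theta_glued_nonneg` : `θ Ψ_{w₁₁} ≥ 0`;
* `championStabilityPair_twoPort_lb` : `Ψ_w ≥ min 0 ((1 − θ)(μ_{w₀₀}(R_c) − μ_{w₀₀}(L_u)) + θ Ψ_{w₁₁})`, from
  `Ψ_w = (1−β)(1−β')Ψ₀₀ + β(1−β')Ψ₁₀ + (1−β)β'Ψ₀₁ + ββ'Ψ₁₁ ≥ (1−θ)·min(Ψ₀₀,Ψ₁₀,Ψ₀₁) + θΨ₁₁`;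
* `championStabilityPair_twoPort_of_witness` : if `c` is a valid cumulative-isolation witness for `u` in the deleted graph,
  `μ_{w₀₀}(1 ≤ |π(u)| ≤ j) ≤ μ_{w₀₀}(|π(c)| ≤ j)`, then CS₂ `μ_w(ℓ) ≤ μ_w(ρ)` — the conclusion of `stub_championStabilityPair`
  at `(x,y) = (u,v)`.  This extends `championStabilityPair_starPartner` in the two-port case (there `u` is a star and `c` a
  champion of `w₀₀`) and covers ≈ 99 % of the "double switches" at `(|A|,j) = (5,2)` (memo);
* `championStabilityPair_twoPort_of_mixed` : the same conclusion from the single residual inequality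
  `(1 − θ)(μ_{w₀₀}(R_c) − μ_{w₀₀}(L_u)) + θ Ψ_{w₁₁} ≥ 0` (merge stability for a COMONOTONE two-port star; 0 violations in
  1.7·10⁴ exact checks, open).
No definitions, no named facts, no sorries.
-/

noncomputable section

namespace Summit.CriticalPhenomena.PercolationContinuityZ3.Theorems

open MeasureTheory Set Literature.Probability.LatticeModels Literature.Probability.Percolation
open scoped Classical BigOperators

variable {n : ℕ}


open TwoPortPeeling in
/-- **CS₂ for a two-port star partner — the mixed-slice lower bound.**  For bond percolation with arbitrary edge probabilities on
`Fin n`, relays `A`, a level `j`, any vertex `u`, a vertex `v ∉ A` whose only pairs of possibly positive weight are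
`s(v,b)`, `s(v,b')` for two relays `b ≠ b'` (`θ := w s(v,b) · w s(v,b')`), and a champion `c ∈ A` of `w`:
`μ_w(ρ) − μ_w(ℓ) ≥ min 0 ((1 − θ)·(μ_{w₀₀}(|π(c)| ≤ j) − μ_{w₀₀}(1 ≤ |π(u)| ≤ j)) + θ·Ψ_{w₁₁})`,
where `ℓ = {c ↮ u, c ↮ v, 1 ≤ |π(u) ∪ π(v)| ≤ j}`, `ρ = {c ↮ u, c ↮ v, |π(c)| ≤ j}`, `w₀₀ = w[s(v,b)↦0][s(v,b')↦0]` (the star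
deleted), `w₁₁ = w[s(v,b)↦1][s(v,b')↦1]` (`v` glued to both ports), `Ψ_{w₁₁} = μ_{w₁₁}(ρ) − μ_{w₁₁}(ℓ)`.  Proof: two-bond
decomposition `Ψ_w = (1−β)(1−β')Ψ₀₀ + β(1−β')Ψ₁₀ + (1−β)β'Ψ₀₁ + ββ'Ψ₁₁ ≥ (1−θ)·min(Ψ₀₀,Ψ₁₀,Ψ₀₁) + θΨ₁₁` and the three facts
`mixed_hubMove` (twice), `theta_glued_nonneg`, `slice_empty_lb`.
[cite: VandenbergHaggstromKahn2005, Thm. 1.5 (p. 7) — via Literature…twoObserver_le_of_lonelier] -/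
theorem championStabilityPair_twoPort_lb (w : Sym2 (Fin n) → unitInterval) (A : Finset (Fin n))
    (u v b b' c : Fin n) (j : ℕ) (hv : v ∉ A) (hb : b ∈ A) (hb' : b' ∈ A) (hbb' : b ≠ b') (hc : c ∈ A)
    (hvtwo : ∀ y : Fin n, y ≠ v → y ≠ b → y ≠ b' → w s(v, y) = 0)
    (hchamp : ∀ a ∈ A,
      (prodBernoulli w).real {ω : BondConfig (Fin n) | (A.filter fun x => ω ∈ openConn a x).card ≤ j} ≤
        (prodBernoulli w).real {ω : BondConfig (Fin n) | (A.filter fun x => ω ∈ openConn c x).card ≤ j}) :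
    min 0 ((1 - (w s(v, b) : ℝ) * w s(v, b')) *
          ((prodBernoulli (Function.update (Function.update w s(v, b) 0) s(v, b') 0)).real
              {ω : BondConfig (Fin n) | (A.filter fun z => ω ∈ openConn c z).card ≤ j} -
            (prodBernoulli (Function.update (Function.update w s(v, b) 0) s(v, b') 0)).real
              {ω : BondConfig (Fin n) | 1 ≤ (A.filter fun z => ω ∈ openConn u z).card ∧
                (A.filter fun z => ω ∈ openConn u z).card ≤ j}) +
        ((w s(v, b) : ℝ) * w s(v, b')) *
          ((prodBernoulli (Function.update (Function.update w s(v, b) 1) s(v, b') 1)).real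
              {ω : BondConfig (Fin n) | ω ∉ openConn c u ∧ ω ∉ openConn c v ∧
                (A.filter fun z => ω ∈ openConn c z).card ≤ j} -
            (prodBernoulli (Function.update (Function.update w s(v, b) 1) s(v, b') 1)).real
              {ω : BondConfig (Fin n) | ω ∉ openConn c u ∧ ω ∉ openConn c v ∧
                1 ≤ (A.filter fun z => ω ∈ openConn u z ∨ ω ∈ openConn v z).card ∧
                (A.filter fun z => ω ∈ openConn u z ∨ ω ∈ openConn v z).card ≤ j})) ≤
      (prodBernoulli w).real {ω : BondConfig (Fin n) | ω ∉ openConn c u ∧ ω ∉ openConn c v ∧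
          (A.filter fun z => ω ∈ openConn c z).card ≤ j} -
        (prodBernoulli w).real {ω : BondConfig (Fin n) | ω ∉ openConn c u ∧ ω ∉ openConn c v ∧
          1 ≤ (A.filter fun z => ω ∈ openConn u z ∨ ω ∈ openConn v z).card ∧
          (A.filter fun z => ω ∈ openConn u z ∨ ω ∈ openConn v z).card ≤ j} := by
  have hbv : b ≠ v := fun h => hv (h ▸ hb)
  have hb'v : b' ≠ v := fun h => hv (h ▸ hb')
  have hee := port_ne hbb' hbv
  set e : Sym2 (Fin n) := s(v, b) with he
  set e' : Sym2 (Fin n) := s(v, b') with he'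
  set ρ : Set (BondConfig (Fin n)) := {ω | ω ∉ openConn c u ∧ ω ∉ openConn c v ∧
      (A.filter fun z => ω ∈ openConn c z).card ≤ j} with hρ
  set ℓ : Set (BondConfig (Fin n)) := {ω | ω ∉ openConn c u ∧ ω ∉ openConn c v ∧
      1 ≤ (A.filter fun z => ω ∈ openConn u z ∨ ω ∈ openConn v z).card ∧
      (A.filter fun z => ω ∈ openConn u z ∨ ω ∈ openConn v z).card ≤ j} with hℓ
  set w00 := Function.update (Function.update w e 0) e' 0 with hw00
  set w10 := Function.update (Function.update w e 1) e' 0 with hw10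
  set w01 := Function.update (Function.update w e 0) e' 1 with hw01
  set w11 := Function.update (Function.update w e 1) e' 1 with hw11
  set p : ℝ := (w e : ℝ) with hp
  set q : ℝ := (w e' : ℝ) with hq
  have hp0 : 0 ≤ p := (w e).2.1
  have hp1 : p ≤ 1 := (w e).2.2
  have hq0 : 0 ≤ q := (w e').2.1
  have hq1 : q ≤ 1 := (w e').2.2
  -- the four slice values
  set a00 := (prodBernoulli w00).real ρ - (prodBernoulli w00).real ℓ with ha00
  set a10 := (prodBernoulli w10).real ρ - (prodBernoulli w10).real ℓ with ha10
  set a01 := (prodBernoulli w01).real ρ - (prodBernoulli w01).real ℓ with ha01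
  set a11 := (prodBernoulli w11).real ρ - (prodBernoulli w11).real ℓ with ha11
  set A0 := (prodBernoulli w00).real {ω : BondConfig (Fin n) | (A.filter fun z => ω ∈ openConn c z).card ≤ j} -
      (prodBernoulli w00).real {ω : BondConfig (Fin n) | 1 ≤ (A.filter fun z => ω ∈ openConn u z).card ∧
        (A.filter fun z => ω ∈ openConn u z).card ≤ j} with hA0
  -- FACT 1 (both ports), FACT 2, the empty slice
  have F1 : 0 ≤ (1 - p * q) * a10 + p * q * a11 := mixed_hubMove w A u v b b' c j hv hb hb' hbb' hc hvtwo hchamp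
  have F1' : 0 ≤ (1 - p * q) * a01 + p * q * a11 := by
    have hvtwo' : ∀ y : Fin n, y ≠ v → y ≠ b' → y ≠ b → w s(v, y) = 0 := fun y h1 h2 h3 => hvtwo y h1 h3 h2
    have h := mixed_hubMove w A u v b' b c j hv hb' hb hbb'.symm hc hvtwo' hchamp
    have hc01 : Function.update (Function.update w e' 1) e 0 = w01 := by
      rw [hw01]; exact Function.update_comm hee.symm _ _ _
    have hc11 : Function.update (Function.update w e' 1) e 1 = w11 := by
      rw [hw11]; exact Function.update_comm hee.symm _ _ _
    rw [hc01, hc11] at h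
    have hcomm : (w e' : ℝ) * w e = p * q := mul_comm _ _
    rw [hcomm] at h
    exact h
  have F2 : 0 ≤ p * q * a11 := theta_glued_nonneg w A u v b b' c j hv hb hb' hbb' hc hvtwo hchamp
  have S0 : A0 ≤ a00 := slice_empty_lb w00 A u v c j hv hc (deleted_zero_at w hbb' hbv hvtwo)
  -- two-bond decomposition of `Ψ_w`
  have hdec : (prodBernoulli w).real ρ - (prodBernoulli w).real ℓ =
      (1 - p) * (1 - q) * a00 + p * (1 - q) * a10 + (1 - p) * q * a01 + p * q * a11 := by
    rw [real_twoBond w hee ρ, real_twoBond w hee ℓ]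
    ring
  rw [hdec]
  -- `m := min (min A0 a10) a01` is below the three single slices and `(1-θ)m + θ a11 ≥ min 0 E`
  set m := min (min A0 a10) a01 with hm
  have hm00 : m ≤ a00 := (min_le_left _ _).trans ((min_le_left _ _).trans S0)
  have hm10 : m ≤ a10 := (min_le_left _ _).trans (min_le_right _ _)
  have hm01 : m ≤ a01 := min_le_right _ _
  have hlow : min 0 ((1 - p * q) * A0 + p * q * a11) ≤ (1 - p * q) * m + p * q * a11 := by
    have h1pq : 0 ≤ 1 - p * q := by nlinarith
    rcases min_cases (min A0 a10) a01 with ⟨h1, -⟩ | ⟨h1, -⟩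
    · rcases min_cases A0 a10 with ⟨h2, -⟩ | ⟨h2, -⟩
      · rw [hm, h1, h2]; exact min_le_right _ _
      · rw [hm, h1, h2]; exact (min_le_left _ _).trans F1
    · rw [hm, h1]; exact (min_le_left _ _).trans F1'
  have hid : (1 - p) * (1 - q) * a00 + p * (1 - q) * a10 + (1 - p) * q * a01 + p * q * a11 -
      ((1 - p * q) * m + p * q * a11) =
      (1 - p) * (1 - q) * (a00 - m) + p * (1 - q) * (a10 - m) + (1 - p) * q * (a01 - m) := by ring
  have t1 : 0 ≤ (1 - p) * (1 - q) * (a00 - m) :=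
    mul_nonneg (mul_nonneg (sub_nonneg.2 hp1) (sub_nonneg.2 hq1)) (sub_nonneg.2 hm00)
  have t2 : 0 ≤ p * (1 - q) * (a10 - m) := mul_nonneg (mul_nonneg hp0 (sub_nonneg.2 hq1)) (sub_nonneg.2 hm10)
  have t3 : 0 ≤ (1 - p) * q * (a01 - m) := mul_nonneg (mul_nonneg (sub_nonneg.2 hp1) hq0) (sub_nonneg.2 hm01)
  linarith

open TwoPortPeeling in
/-- **CS₂ for a two-port star partner from the comonotone residual.**  Setting of `championStabilityPair_twoPort_lb`; if
`(1 − θ)·(μ_{w₀₀}(|π(c)| ≤ j) − μ_{w₀₀}(1 ≤ |π(u)| ≤ j)) + θ·Ψ_{w₁₁} ≥ 0` — merge stability of `c` for the star whose two ports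
open TOGETHER with probability `θ` — then `μ_w(c ↮ u, c ↮ v, 1 ≤ |π(u) ∪ π(v)| ≤ j) ≤ μ_w(c ↮ u, c ↮ v, |π(c)| ≤ j)`, the
conclusion of `stub_championStabilityPair` at `(x,y) = (u,v)`.
[cite: VandenbergHaggstromKahn2005, Thm. 1.5 (p. 7) — via championStabilityPair_twoPort_lb] -/
theorem championStabilityPair_twoPort_of_mixed (w : Sym2 (Fin n) → unitInterval) (A : Finset (Fin n))
    (u v b b' c : Fin n) (j : ℕ) (hv : v ∉ A) (hb : b ∈ A) (hb' : b' ∈ A) (hbb' : b ≠ b') (hc : c ∈ A)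
    (hvtwo : ∀ y : Fin n, y ≠ v → y ≠ b → y ≠ b' → w s(v, y) = 0)
    (hchamp : ∀ a ∈ A,
      (prodBernoulli w).real {ω : BondConfig (Fin n) | (A.filter fun x => ω ∈ openConn a x).card ≤ j} ≤
        (prodBernoulli w).real {ω : BondConfig (Fin n) | (A.filter fun x => ω ∈ openConn c x).card ≤ j})
    (hE : 0 ≤ (1 - (w s(v, b) : ℝ) * w s(v, b')) *
          ((prodBernoulli (Function.update (Function.update w s(v, b) 0) s(v, b') 0)).real
              {ω : BondConfig (Fin n) | (A.filter fun z => ω ∈ openConn c z).card ≤ j} -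
            (prodBernoulli (Function.update (Function.update w s(v, b) 0) s(v, b') 0)).real
              {ω : BondConfig (Fin n) | 1 ≤ (A.filter fun z => ω ∈ openConn u z).card ∧
                (A.filter fun z => ω ∈ openConn u z).card ≤ j}) +
        ((w s(v, b) : ℝ) * w s(v, b')) *
          ((prodBernoulli (Function.update (Function.update w s(v, b) 1) s(v, b') 1)).real
              {ω : BondConfig (Fin n) | ω ∉ openConn c u ∧ ω ∉ openConn c v ∧
                (A.filter fun z => ω ∈ openConn c z).card ≤ j} -
            (prodBernoulli (Function.update (Function.update w s(v, b) 1) s(v, b') 1)).real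
              {ω : BondConfig (Fin n) | ω ∉ openConn c u ∧ ω ∉ openConn c v ∧
                1 ≤ (A.filter fun z => ω ∈ openConn u z ∨ ω ∈ openConn v z).card ∧
                (A.filter fun z => ω ∈ openConn u z ∨ ω ∈ openConn v z).card ≤ j})) :
    (prodBernoulli w).real {ω : BondConfig (Fin n) | ω ∉ openConn c u ∧ ω ∉ openConn c v ∧
        1 ≤ (A.filter fun z => ω ∈ openConn u z ∨ ω ∈ openConn v z).card ∧
        (A.filter fun z => ω ∈ openConn u z ∨ ω ∈ openConn v z).card ≤ j} ≤
      (prodBernoulli w).real {ω : BondConfig (Fin n) | ω ∉ openConn c u ∧ ω ∉ openConn c v ∧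
        (A.filter fun z => ω ∈ openConn c z).card ≤ j} := by
  have h := championStabilityPair_twoPort_lb w A u v b b' c j hv hb hb' hbb' hc hvtwo hchamp
  rw [min_eq_left hE] at h
  linarith

open TwoPortPeeling in
/-- **CS₂ for a two-port star partner whenever the champion is a valid witness for `u` in the deleted graph.**  For bond
percolation with arbitrary edge probabilities on `Fin n`, relays `A`, a level `j`, ANY vertex `u`, a vertex `v ∉ A`
whose only pairs of possibly positive weight go to two relays `b ≠ b'`, and a champion `c ∈ A` of `w`: if, with `v`'s star
deleted (`w₀₀`), `μ_{w₀₀}(1 ≤ |π(u)| ≤ j) ≤ μ_{w₀₀}(|π(c)| ≤ j)` (e.g. `c` a champion of `w₀₀` and `u` any observer for which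
cumulative isolation is known there), then `μ_w(c ↮ u, c ↮ v, 1 ≤ |π(u) ∪ π(v)| ≤ j) ≤ μ_w(c ↮ u, c ↮ v, |π(c)| ≤ j)`.
Extends `championStabilityPair_starPartner` (two-port case) to arbitrary `u` and to non-champion witnesses.
[cite: VandenbergHaggstromKahn2005, Thm. 1.5 (p. 7) — via championStabilityPair_twoPort_lb] -/
theorem championStabilityPair_twoPort_of_witness (w : Sym2 (Fin n) → unitInterval) (A : Finset (Fin n))
    (u v b b' c : Fin n) (j : ℕ) (hv : v ∉ A) (hb : b ∈ A) (hb' : b' ∈ A) (hbb' : b ≠ b') (hc : c ∈ A)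
    (hvtwo : ∀ y : Fin n, y ≠ v → y ≠ b → y ≠ b' → w s(v, y) = 0)
    (hchamp : ∀ a ∈ A,
      (prodBernoulli w).real {ω : BondConfig (Fin n) | (A.filter fun x => ω ∈ openConn a x).card ≤ j} ≤
        (prodBernoulli w).real {ω : BondConfig (Fin n) | (A.filter fun x => ω ∈ openConn c x).card ≤ j})
    (hA : (prodBernoulli (Function.update (Function.update w s(v, b) 0) s(v, b') 0)).real
          {ω : BondConfig (Fin n) | 1 ≤ (A.filter fun z => ω ∈ openConn u z).card ∧
            (A.filter fun z => ω ∈ openConn u z).card ≤ j} ≤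
        (prodBernoulli (Function.update (Function.update w s(v, b) 0) s(v, b') 0)).real
          {ω : BondConfig (Fin n) | (A.filter fun z => ω ∈ openConn c z).card ≤ j}) :
    (prodBernoulli w).real {ω : BondConfig (Fin n) | ω ∉ openConn c u ∧ ω ∉ openConn c v ∧
        1 ≤ (A.filter fun z => ω ∈ openConn u z ∨ ω ∈ openConn v z).card ∧
        (A.filter fun z => ω ∈ openConn u z ∨ ω ∈ openConn v z).card ≤ j} ≤
      (prodBernoulli w).real {ω : BondConfig (Fin n) | ω ∉ openConn c u ∧ ω ∉ openConn c v ∧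
        (A.filter fun z => ω ∈ openConn c z).card ≤ j} := by
  refine championStabilityPair_twoPort_of_mixed w A u v b b' c j hv hb hb' hbb' hc hvtwo hchamp ?_
  have F2 := theta_glued_nonneg w A u v b b' c j hv hb hb' hbb' hc hvtwo hchamp
  have h1θ : 0 ≤ 1 - (w s(v, b) : ℝ) * w s(v, b') := by
    nlinarith [(w s(v, b)).2.1, (w s(v, b)).2.2, (w s(v, b')).2.1, (w s(v, b')).2.2]
  nlinarith [mul_nonneg h1θ (sub_nonneg.2 hA), F2]

end Summit.CriticalPhenomena.PercolationContinuityZ3.Theorems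

end
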